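import Summits.AnomalousDissipation.AnomalousDissipation.Theorems.BaireTransferRobustLoudUpgradeStubScalingLoud
import Summits.AnomalousDissipation.AnomalousDissipation.Theorems.BaireTransferRobustLoudUpgradeStubPeriodicRobustCrossingClosure

/-!
# Stub `stub_scalingCrossingClosurePeriodic` of the line `malkin-cone-group-orbits`
# (crux stmt-AnomalousDissipation-1144, `BaireTransfer.RobustLoudUpgrade`; companion c4, engine E′, periodic)

The SCALING-CROSSING ENGINE of the companion skeleton c4 ("the viscosity unfolding"), periodic case:
the landed engine `PeriodicRobustCrossingClosure.stub_periodicRobustCrossingClosure` (engine E2 of c3)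
with ONE change — the strict sign change of the reduced function `σ` is asked on the SHEET
`(s, x) ↦ σ (s • c₁, x)` near `(1, 0)` instead of the line `x ↦ σ (c₁, x)`, at forces `c₁`
arbitrarily close to `c`.  The dilation `s` of the force is undone by the parabolic NS scaling, which
is available because the viscosity is free in `LOUD`.

Data: a `τ`-periodic classical solution `u` of `NS_ν(f_c)` on `ℝ × T³`, `ν ∈ (0,a)`, with STRICT
budgets `⟨‖u‖²⟩ < E`, `ε < ⟨ν‖∇u‖²⟩`, and `σ : P_S × ℝ → ℝ` such that

* for every `δ > 0`, on some ball around `(c, 0)` the function `σ` is continuous and each of its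
  zeros `q = (c', x)` yields a `τ'`-periodic classical solution `u'` of `NS_ν(f_{c'})` with
  `∫‖u'(t) − u(τt/τ')‖² + ‖∇(u'(t) − u(τt/τ'))‖₂² ≤ δ` for all `t`;
* for every `η > 0` there are `c₁` with `dist c₁ c < η` and `s₁, s₂ ∈ (1 - η, 1 + η)`,
  `x₁, x₂ ∈ (-η, η)` with `σ (s₁ • c₁, x₁) < 0 < σ (s₂ • c₁, x₂)`.

Conclusion: `c ∈ closure (interior (loud S a E ε))`.

Proof.  (1) Intermediate level and budgets `ν < a' < a`, `⟨‖u‖²⟩ < E' < E`, `ε < ε' < ⟨ν‖∇u‖²⟩`.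
(2) `PeriodicRobustCrossingClosure.exists_window` at `(a', E', ε')` gives `δ > 0` such that every
periodic classical solution of `NS_ν(f_e)` that is `δ`-close to the time-rescaled `u` makes
`e ∈ loud S a' E' ε'`.  (3) `Scaling.exists_scale_margin` gives the scaling margin `κ`: for
`|s − 1| < κ` the undoing factor `α = (√s)⁻¹` moves `(a', E', ε')` inside `(a, E, ε)`.  (4) The
family hypothesis at `δ` gives the radius `r`; joint continuity of `(s, c') ↦ s • c'` at `(1, c)`
gives `η₀` with `dist (s • c') c < r` for `|s − 1|, dist c' c < η₀`.  (5) CLOSURE: given `θ > 0`,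
the sign hypothesis with `η ≤ θ, κ, η₀/2, r/2` gives `c₁, s₁, s₂, x₁, x₂`; continuity of
`c' ↦ σ (sᵢ • c', xᵢ)` at `c₁` keeps the strict signs on a ball around `c₁`; for `c'` in that ball
(and `η₀/2`-close to `c₁`) the segment `θ' ↦ ((s₁ + θ'(s₂ − s₁)) • c', x₁ + θ'(x₂ − x₁))`,
`θ' ∈ [0, 1]`, lies in the ball of radius `r` around `(c, 0)` (sup metric), so the intermediate
value theorem produces a zero `(s⋆ • c', x⋆)` of `σ` with `|s⋆ − 1| < κ`, hence a `δ`-close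
periodic solution of `f_{s⋆ c'}` at `ν`, hence `s⋆ • c' ∈ loud S a' E' ε'` by (2), hence
`c' = (√s⋆)⁻² • (s⋆ • c') ∈ loud S a E ε` by `Scaling.scaling_mem_loud` and (3).  Thus a ball
around `c₁` is loud, `c₁ ∈ interior loud`, and `dist c c₁ < θ`.

References: D. Henry, *Geometric Theory of Semilinear Parabolic Equations*, LNM 840 (1981), Ch. 8;
the vocabulary module `Theorems/BaireTransferRobustLoudUpgradeLine.lean`; the templates
`Theorems/BaireTransferRobustLoudUpgradeStubPeriodicRobustCrossingClosure.lean` (engine E2) and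
`Theorems/BaireTransferRobustLoudUpgradeStubScalingLoud.lean` (scaling lemmas).
-/

-- `Summit.<Summit>.<Problem>` is the tree's mandated summit-side namespace (CONVENTIONS §2); for this
-- single-conjunct summit the two coincide, so the duplicate is deliberate.
set_option linter.dupNamespace false

noncomputable section

open scoped BigOperators Topology
open Filter Set Function TopologicalSpace MeasureTheory

namespace Summit.AnomalousDissipation.AnomalousDissipation.Theorems.RobustLoudUpgrade.ScalingCrossing

open Literature.Analysis.FunctionSpaces Literature.Analysis.FunctionSpaces.Torus
open Literature.Analysis.FluidPDE
open Summit.AnomalousDissipation.AnomalousDissipation.Theses.BaireTransfer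
open Summit.AnomalousDissipation.AnomalousDissipation.Theorems.RobustLoudUpgrade

/-! ## Sup-metric and segment bookkeeping on `P_S × ℝ` -/

/-- Sup metric on a product: `(c', x)` is `ρ`-close to `(c, 0)` as soon as `dist c' c < ρ` and
`|x| < ρ`. [folklore] -/
private lemma dist_mk_lt_periodic {V : Type*} [PseudoMetricSpace V] {c' c : V} {x ρ : ℝ}
    (hc : dist c' c < ρ) (hx : |x| < ρ) : dist (c', x) (c, (0 : ℝ)) < ρ := by
  -- adapted from Theorems/BaireTransferRobustLoudUpgradeStubPeriodicRobustCrossingClosure.lean `dist_mk_lt`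
  rw [Prod.dist_eq]
  show max (dist c' c) (dist x 0) < ρ
  rw [Real.dist_eq, sub_zero]
  exact max_lt hc hx

/-- A point of the unordered segment `[[x₁, x₂]]` is no larger in absolute value than the larger
endpoint: `|x₁| < b`, `|x₂| < b`, `x ∈ [[x₁, x₂]]` give `|x| < b`. [folklore] -/
private lemma abs_lt_of_mem_uIcc_periodic {x₁ x₂ x b : ℝ} (h₁ : |x₁| < b) (h₂ : |x₂| < b)
    (hx : x ∈ Set.uIcc x₁ x₂) : |x| < b := by
  -- adapted from Theorems/BaireTransferRobustLoudUpgradeStubPeriodicRobustCrossingClosure.lean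
  rw [abs_lt] at h₁ h₂ ⊢
  rcases Set.mem_uIcc.1 hx with ⟨hl, hu⟩ | ⟨hl, hu⟩
  · exact ⟨by linarith [h₁.1], by linarith [h₂.2]⟩
  · exact ⟨by linarith [h₂.1], by linarith [h₁.2]⟩

/-- The affine parametrisation `θ ↦ x₁ + θ (x₂ - x₁)` of `[0, 1]` stays in the unordered segment
`[[x₁, x₂]]`. [folklore] -/
private lemma add_mul_sub_mem_uIcc {x₁ x₂ θ : ℝ} (hθ : θ ∈ Set.Icc (0 : ℝ) 1) :
    x₁ + θ * (x₂ - x₁) ∈ Set.uIcc x₁ x₂ :=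
  (convex_uIcc x₁ x₂).add_smul_sub_mem Set.left_mem_uIcc Set.right_mem_uIcc hθ

/-- Along the affine parametrisation of `[0, 1]`, a bound `|xᵢ| < b` at both endpoints persists:
`|x₁ + θ (x₂ - x₁)| < b`. [folklore] -/
private lemma abs_add_mul_sub_lt {x₁ x₂ θ b : ℝ} (h₁ : |x₁| < b) (h₂ : |x₂| < b)
    (hθ : θ ∈ Set.Icc (0 : ℝ) 1) : |x₁ + θ * (x₂ - x₁)| < b :=
  abs_lt_of_mem_uIcc_periodic h₁ h₂ (add_mul_sub_mem_uIcc hθ)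

/-- Along the affine parametrisation of `[0, 1]`, a bound `|sᵢ - 1| < b` at both endpoints
persists: `|s₁ + θ (s₂ - s₁) - 1| < b`. [folklore] -/
private lemma abs_add_mul_sub_sub_one_lt {s₁ s₂ θ b : ℝ} (h₁ : |s₁ - 1| < b) (h₂ : |s₂ - 1| < b)
    (hθ : θ ∈ Set.Icc (0 : ℝ) 1) : |s₁ + θ * (s₂ - s₁) - 1| < b := by
  have h := abs_add_mul_sub_lt h₁ h₂ hθ
  have he : s₁ - 1 + θ * (s₂ - 1 - (s₁ - 1)) = s₁ + θ * (s₂ - s₁) - 1 := by ring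
  rwa [he] at h

/-- Joint continuity of the dilation `(s, c') ↦ s • c'` at `(1, c)`, quantitatively: for every
`r > 0` there is `η₀ > 0` with `dist (s • c') c < r` whenever `|s - 1| < η₀` and `dist c' c < η₀`.
[folklore] -/
private lemma exists_smul_close {V : Type*} [NormedAddCommGroup V] [NormedSpace ℝ V] (c : V)
    {r : ℝ} (hr : 0 < r) :
    ∃ η₀ : ℝ, 0 < η₀ ∧ ∀ (s : ℝ) (c' : V), |s - 1| < η₀ → dist c' c < η₀ → dist (s • c') c < r := by
  have hc : Continuous fun q : ℝ × V => q.1 • q.2 := continuous_smul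
  obtain ⟨η₀, hη₀, h⟩ := Metric.continuous_iff.1 hc ((1 : ℝ), c) r hr
  refine ⟨η₀, hη₀, fun s c' hs hc' => ?_⟩
  have hd : dist ((s, c') : ℝ × V) ((1 : ℝ), c) < η₀ := by
    rw [Prod.dist_eq, Real.dist_eq]
    exact max_lt hs hc'
  simpa using h (s, c') hd

/-! ## The stub -/

/-- **Scaling crossing ⇒ closure of the loud interior, periodic case** (registered stub
`stub_scalingCrossingClosurePeriodic` of the line `malkin-cone-group-orbits`, companion c4,
engine E′).  At a loud `τ`-periodic classical witness `u` with STRICT budgets, a real family `σ`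
which is continuous near `(c, 0)` with zeros giving uniformly `L² ∩ Ḣ¹`-close periodic classical
solutions (for every closeness `δ`), and which changes sign strictly on the sheet
`(s, x) ↦ σ (s • c₁, x)` near `(1, 0)` at forces `c₁` arbitrarily close to `c`, puts `c` in
`closure (interior (loud S a E ε))`: the strict sign change persists for `c'` near `c₁`, the
intermediate value theorem on the sheet gives a zero `(s⋆ • c', x⋆)` of `σ`, hence a periodic
solution of `f_{s⋆ c'}` inside the INTERMEDIATE budget window of `u`, and the parabolic scaling by
`α = (√s⋆)⁻¹` turns it into a witness of `f_{c'}` inside the original window, so a ball around `c₁`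
is loud. [folklore] -/
theorem stub_scalingCrossingClosurePeriodic : ∀ (S : Finset (Fin 3 → ℤ)) (a E ε : ℝ) (c : Coeff S) (ν τ : ℝ) (u : ℝ → UnitAddTorus (Fin 3) → EuclideanSpace ℝ (Fin 3)) (p : ℝ → UnitAddTorus (Fin 3) → ℝ) (σ : Coeff S × ℝ → ℝ), 0 < ν → ν < a → 0 < τ → IsClassicalNSSolutionOn Set.univ ν (fun _ => force S c) u p → Function.Periodic u τ → meanEnergy u < E → ε < meanDissipation ν u → (∀ δ : ℝ, 0 < δ → ∃ r : ℝ, 0 < r ∧ ContinuousOn σ (Metric.ball (c, (0 : ℝ)) r) ∧ ∀ q ∈ Metric.ball (c, (0 : ℝ)) r, σ q = 0 → ∃ (τ' : ℝ) (u' : ℝ → UnitAddTorus (Fin 3) → EuclideanSpace ℝ (Fin 3)) (p' : ℝ → UnitAddTorus (Fin 3) → ℝ), 0 < τ' ∧ IsClassicalNSSolutionOn Set.univ ν (fun _ => force S q.1) u' p' ∧ Function.Periodic u' τ' ∧ ∀ t, (∫ x, ‖u' t x - u (τ / τ' * t) x‖ ^ 2) + gradNormSq (fun x => u' t x - u (τ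 / τ' * t) x) ≤ δ) → (∀ η : ℝ, 0 < η → ∃ (c₁ : Coeff S) (s₁ s₂ x₁ x₂ : ℝ), dist c₁ c < η ∧ |s₁ - 1| < η ∧ |s₂ - 1| < η ∧ |x₁| < η ∧ |x₂| < η ∧ σ (s₁ • c₁, x₁) < 0 ∧ 0 < σ (s₂ • c₁, x₂)) → c ∈ closure (interior (loud S a E ε)) := by
  -- adapted from Theorems/BaireTransferRobustLoudUpgradeStubPeriodicRobustCrossingClosure.lean
  -- `stub_periodicRobustCrossingClosure` (engine E2), with the IVT on the sheet and the scaling undone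
  intro S a E ε c ν τ u p σ hν hνa hτ hsol hper hE hε hzero hcross
  -- (1) intermediate level and budgets
  obtain ⟨a', hνa', ha'a⟩ := exists_between hνa
  obtain ⟨E', hEE', hE'E⟩ := exists_between hE
  obtain ⟨ε', hεε', hε'D⟩ := exists_between hε
  -- (2) the budget window of `u` at the intermediate data
  obtain ⟨δ, hδ0, hwin⟩ :=
    PeriodicRobustCrossingClosure.exists_window (a := a') hν hνa' hτ hsol hper hEE' hε'D
  -- (3) the scaling margin
  obtain ⟨κ, hκ, hmargin⟩ := Scaling.exists_scale_margin ha'a hE'E hεε'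
  -- (4) on a ball around `(c, 0)`, `σ` is continuous and its zeros give `δ`-close periodic solutions
  obtain ⟨r, hr, hcont, hz⟩ := hzero δ hδ0
  -- joint continuity of the dilation at `(1, c)`
  obtain ⟨η₀, hη₀, hsmul⟩ := exists_smul_close c hr
  -- (5) closure
  rw [Metric.mem_closure_iff]
  intro θ hθ
  obtain ⟨η, hη, hηθ, hηκ, hηη₀, hηr⟩ :
      ∃ η : ℝ, 0 < η ∧ η ≤ θ ∧ η ≤ κ ∧ η ≤ η₀ / 2 ∧ η ≤ r / 2 :=
    ⟨min (min θ κ) (min (η₀ / 2) (r / 2)),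
      lt_min (lt_min hθ hκ) (lt_min (half_pos hη₀) (half_pos hr)),
      (min_le_left _ _).trans (min_le_left _ _), (min_le_left _ _).trans (min_le_right _ _),
      (min_le_right _ _).trans (min_le_left _ _), (min_le_right _ _).trans (min_le_right _ _)⟩
  obtain ⟨c₁, s₁, s₂, x₁, x₂, hc₁, hs₁, hs₂, hx₁, hx₂, hσ₁, hσ₂⟩ := hcross η hη
  -- points of the sheet over forces `η₀/2`-close to `c₁` lie in the ball of radius `r`
  have hball : ∀ (c' : Coeff S) (s x : ℝ), dist c' c₁ < η₀ / 2 → |s - 1| < η → |x| < η →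
      ((s • c', x) : Coeff S × ℝ) ∈ Metric.ball (c, (0 : ℝ)) r := by
    intro c' s x hc' hs hx
    have hc'c : dist c' c < η₀ :=
      calc dist c' c ≤ dist c' c₁ + dist c₁ c := dist_triangle _ _ _
        _ < η₀ / 2 + η₀ / 2 := add_lt_add hc' (hc₁.trans_le hηη₀)
        _ = η₀ := add_halves η₀
    have hs' : |s - 1| < η₀ := hs.trans_le (hηη₀.trans (half_le_self hη₀.le))
    exact Metric.mem_ball.2
      (dist_mk_lt_periodic (hsmul s c' hs' hc'c) (hx.trans_le (hηr.trans (half_le_self hr.le))))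
  -- `c' ↦ σ (s • c', x)` is continuous at `c₁` whenever `|s - 1| < η`, `|x| < η`
  have hat : ∀ s x : ℝ, |s - 1| < η → |x| < η →
      ContinuousAt (fun c' : Coeff S => σ (s • c', x)) c₁ := by
    intro s x hs hx
    have hmem := hball c₁ s x (by rw [dist_self]; exact half_pos hη₀) hs hx
    have hca : ContinuousAt σ (s • c₁, x) := hcont.continuousAt (Metric.isOpen_ball.mem_nhds hmem)
    have hf : Continuous fun c' : Coeff S => ((s • c', x) : Coeff S × ℝ) := by fun_prop
    exact ContinuousAt.comp' (f := fun c' : Coeff S => ((s • c', x) : Coeff S × ℝ)) (x := c₁) hca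
      hf.continuousAt
  -- the strict signs persist on a ball around `c₁`
  have h₁ : ∀ᶠ c' in 𝓝 c₁, σ (s₁ • c', x₁) < 0 :=
    Filter.Tendsto.eventually_lt_const hσ₁ (hat s₁ x₁ hs₁ hx₁)
  have h₂ : ∀ᶠ c' in 𝓝 c₁, 0 < σ (s₂ • c', x₂) :=
    Filter.Tendsto.eventually_const_lt hσ₂ (hat s₂ x₂ hs₂ hx₂)
  obtain ⟨ρ', hρ', hρ'σ⟩ := Metric.eventually_nhds_iff.1 (h₁.and h₂)
  obtain ⟨ρ, hρ, hρρ', hρη₀⟩ : ∃ ρ : ℝ, 0 < ρ ∧ ρ ≤ ρ' ∧ ρ ≤ η₀ / 2 :=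
    ⟨min ρ' (η₀ / 2), lt_min hρ' (half_pos hη₀), min_le_left _ _, min_le_right _ _⟩
  -- the ball of radius `ρ` around `c₁` is loud
  have hsub : Metric.ball c₁ ρ ⊆ loud S a E ε := by
    intro c' hc'
    rw [Metric.mem_ball] at hc'
    have hc'η₀ : dist c' c₁ < η₀ / 2 := hc'.trans_le hρη₀
    obtain ⟨hneg, hpos⟩ := hρ'σ (hc'.trans_le hρρ')
    -- the segment of the sheet from `(s₁ • c', x₁)` to `(s₂ • c', x₂)` lies in the ball of radius `r`
    have hseg : Set.MapsTo
        (fun θ' : ℝ => (((s₁ + θ' * (s₂ - s₁)) • c', x₁ + θ' * (x₂ - x₁)) : Coeff S × ℝ))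
        (Set.Icc (0 : ℝ) 1) (Metric.ball (c, (0 : ℝ)) r) := fun θ' hθ' =>
      hball c' _ _ hc'η₀ (abs_add_mul_sub_sub_one_lt hs₁ hs₂ hθ') (abs_add_mul_sub_lt hx₁ hx₂ hθ')
    have hf : Continuous
        fun θ' : ℝ => (((s₁ + θ' * (s₂ - s₁)) • c', x₁ + θ' * (x₂ - x₁)) : Coeff S × ℝ) := by
      fun_prop
    have hcont' : ContinuousOn
        (fun θ' : ℝ => σ ((s₁ + θ' * (s₂ - s₁)) • c', x₁ + θ' * (x₂ - x₁))) (Set.Icc (0 : ℝ) 1) :=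
      hcont.comp hf.continuousOn hseg
    -- intermediate value theorem: a zero of `σ` on the segment
    have hmem : (0 : ℝ) ∈ Set.Icc (σ ((s₁ + 0 * (s₂ - s₁)) • c', x₁ + 0 * (x₂ - x₁)))
        (σ ((s₁ + 1 * (s₂ - s₁)) • c', x₁ + 1 * (x₂ - x₁))) := by
      simp only [zero_mul, add_zero, one_mul, add_sub_cancel]
      exact ⟨hneg.le, hpos.le⟩
    obtain ⟨θ', hθ', hσθ'⟩ := intermediate_value_Icc zero_le_one hcont' hmem
    -- hence a `δ`-close periodic classical solution of `f_{s⋆ • c'}`, hence `s⋆ • c'` is loud at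
    -- the intermediate data
    obtain ⟨τ', u', p', hτ', hsol', hper', hcl⟩ := hz _ (hseg hθ') hσθ'
    have hloud : (s₁ + θ' * (s₂ - s₁)) • c' ∈ loud S a' E' ε' :=
      hwin _ τ' u' p' hτ' hsol' hper' hcl
    -- undo the dilation by the parabolic scaling
    obtain ⟨hs0, hα, hαa, hαE, hαε⟩ :=
      hmargin (s₁ + θ' * (s₂ - s₁)) ((abs_add_mul_sub_sub_one_lt hs₁ hs₂ hθ').trans_le hηκ)
    have h := Scaling.scaling_mem_loud S a a' E E' ε ε' (Real.sqrt (s₁ + θ' * (s₂ - s₁)))⁻¹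
      ((s₁ + θ' * (s₂ - s₁)) • c') hloud hα hαa.le hαE.le hαε.le
    rwa [Scaling.inv_sqrt_sq_smul_smul hs0] at h
  refine ⟨c₁, interior_maximal hsub Metric.isOpen_ball (Metric.mem_ball_self hρ), ?_⟩
  rw [dist_comm]
  exact hc₁.trans_le hηθ

end Summit.AnomalousDissipation.AnomalousDissipation.Theorems.RobustLoudUpgrade.ScalingCrossing

end
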